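import Summits.QuantumFields.YangMills.Theorems.BalabanUVNodesN15BackgroundGaugeMatrixByName
import Summits.QuantumFields.YangMills.Theorems.BalabanUVNodesN15VectorPieceBackgroundMatrix
import HarnessLib

/-!
# Route «BalabanUVNodes» (K4 «SpineRates»), node N15 = NE2 — THE NON-ABELIAN GAUGE-LIVE KNIT: `T4EtaRate.NE2PlusOperator` BY NAME for the U = 1 vector
# single-scale piece `G ⊗ 1_𝔤` DRESSED BY THE PRINT's MATRIX SPECIES — the first-order perturbation's MATRIX coefficients DERIVED from an `𝔄`-valued gauge
# field `A′` through `Phi1(η, ad_A) = η⁻¹(exp(η ad_A) − 1)` in coordinates, (3.35) CONSUMED ON `A′` ITSELF in the norm of `𝔄`, size guard LIVE, all four (3.42)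
# entries CONSTRUCTED, every U ≡ 1 input a tree theorem

Cell `pub-ymgap`, seat `pub-ymgap-dag-n15-c` (generation g2; R134 ACCELERATION SEAT, strategy s1 — g0's located successor object (N1′) «C1∕C2-MATRIX SPECIES»;
HUMAN RULING D-0062; chair R424 venue; `bears_on: R4∕N15`).  Filed `--supports stmt-QuantumFields-19676` (K3 «SpineGivenEndpointR11»; helper).  Plumbing: the
realised non-abelian gauge-field instance ∕ family at a sized index (`gaugeVecInstanceM`, `gaugeVecFamilyM4`); then theorems.  Imports BY NAME, nothing in the tree
modified: this seat's G2 `…N15BackgroundGaugeMatrixByName` (`gaugeInstanceM`, `gaugeFamilyM4`, `ne2PlusOperator_gaugeM`; G1 `gaugeBgM`) and M4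
`…N15VectorPieceBackgroundMatrix` (`tensorId`, `uniform_layer_firstOrderM`; through it n15-a∕-c parts 15∕16∕23∕26∕27∕F3: `unitTorusGeoS`, `pieceG`∕`pieceD1`∕`pieceS`∕
`pieceM`∕`pieceD3`, `thetaV`, `VecIndexS`, `blkFine`, `kingPrV`, `rweight`, `inv_pow_le_rpow`).

WHAT THIS IS.  G2 proves `NE2PlusOperator` BY NAME, with the NON-ABELIAN gauge field live, for ANY family whose only displayed hypotheses are the `U ≡ 1` layer
ON THE PRODUCT CARRIER `X × ι`.  The honest inhabitant (M4 §2): the U = 1 vector single-scale piece `G = H_k·C^{(k)}·(η^{d+1}H_kᵀ)` acting COMPONENTWISE in the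
Lie-algebra index — `G ⊗ 1_𝔤`, Bałaban's `U ≡ 1` Landau-gauge propagator on `𝔤`-valued 1-forms — whose twelve uniform letter families are M4's
`uniform_layer_firstOrderM`; the rate number `θ_j = (L^k)^{−¼}` dominates the spacing `η = L^{−k} ≤ 1` (the `ad`-species fits need `η ≤ θ`).  §2 is ONE
`exact ne2PlusOperator_gaugeM …` — the matrix twin of F3's `ne2PlusOperator_vectorPiece_gauge` (abelian) and the gauge-live twin of M4's
`ne2PlusOperator_vectorPiece_backgroundM₁4` (abstract matrix coefficients).

CONTENTS.
* §1 `gaugeVecInstanceM`, `gaugeVecFamilyM4`, `gaugeVecInstanceM_gf_M` (`rfl`: guard = `j.Msz`, LIVE), `reg335_gaugeVecM_iff` (what (3.35) says here).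
* §2 **`ne2PlusOperator_vectorPiece_gaugeM4`**: for `d + 1 ≥ 2`, `L ≥ 1`, a finite index type `ι`, coordinates `e : 𝔄 ≃L[ℝ] ℝ^ι` and every `c₃₅ > 0`,
  `T4EtaRate.NE2PlusOperator c₃₅ (gaugeVecInstanceM 𝔄 ι L hL) (gaugeVecFamilyM4 𝔄 ι e L hL)` — G2 instantiated; `_dim4`.

HONEST FRAMING ∕ LIMITS.  A knit: no new estimate (every analytic input is a landed theorem of the -a∕-b∕-c chains).  What the statement covers: the LINEAR (U = 1)
vector piece of [B5]∕[B6]∕King (4.42), tensored with `1_𝔤`, dressed by the first-order perturbation whose matrix coefficients are DERIVED from an `𝔄`-valued gauge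
field through the print's transporter species `η⁻¹(exp(η ad_A) − 1)` ([Balaban1985BackgroundPropagators] (3.50) p. 400) — `𝔤` MODELLED by a complete normed
algebra with `ad` = the commutator and a coordinate system (parts 13a–c∕16), one `Phi1` per direction (no second-order `F′_{1,k}` term of (3.51)–(3.52)), linearised
fibrewise-mean transport of the gauge field — NOT the (C3) nonlinear average, NOT the multiscale carrier of NODE 00; one single-scale piece.  Count-neutral (typed
28∕28 · discharged unchanged); NOT a discharge of N15; one finite T⁴ at fixed ε — NOT infinite volume, NOT OS on ℝ⁴, NOT a mass gap, NOT Clay.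
-/

noncomputable section

open scoped BigOperators
open Finset

namespace Summit.QuantumFields.YangMills.BalabanUVNodes.N15.VectorPiece

open Literature.MathematicalPhysics.QuantumFieldTheory.Balaban1983to89
open Literature.MathematicalPhysics.QuantumFieldTheory.Balaban1983to89.B11SectG (BlockNorm HasMaj RowSum)
open Literature.MathematicalPhysics.QuantumFieldTheory.Balaban1983to89.B6RandomWalk (Triangle254)
open Literature.MathematicalPhysics.QuantumFieldTheory.Balaban1983to89.T4EtaRate (PairedInstance NE2PlusOperator)
open Literature.MathematicalPhysics.QuantumFieldTheory.Balaban1983to89.T4EtaRateDefect (idef rateWeight)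
open Literature.MathematicalPhysics.QuantumFieldTheory.Balaban1983to89.T4EtaRateCoeffDefect (pull)
open Literature.MathematicalPhysics.QuantumFieldTheory.Balaban1983to89.B5Prop11Plancherel (Tor fine)
open Literature.MathematicalPhysics.QuantumFieldTheory.Balaban1983to89.B6UnitTorusCarrier (unitTorusGeo unitTorusGeo_len triangle254_unitTorusGeo
  rowSum_unitTorusGeo)
open Literature.MathematicalPhysics.QuantumFieldTheory.King1986.Torus (tdistT tdistT_nonneg)
open Summit.QuantumFields.YangMills.BalabanUVNodes.N15.MatrixSpecies (liftMap liftBlk)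
open Summit.QuantumFields.YangMills.BalabanUVNodes.N15.BackgroundLayer (gaugeInstanceM gaugeFamilyM4 ne2PlusOperator_gaugeM)

variable {d : ℕ}

/-! ## §1 The realised non-abelian gauge-field instance family at the vector piece ⊗ 1_𝔤 -/

section Family

variable (𝔄 : Type) [NormedRing 𝔄] [NormedAlgebra ℝ 𝔄] [CompleteSpace 𝔄] (ι : Type) [Fintype ι] [DecidableEq ι] (e : 𝔄 ≃L[ℝ] (ι → ℝ)) (L : ℕ) [NeZero L]

/-- THE REALISED NON-ABELIAN GAUGE-FIELD INSTANCE at a sized index: G1's `gaugeInstanceM` (configurations = `𝔄`-valued gauge fields `A′ : Fin (d+1) → X′ → 𝔄`,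
`Reg335` = the (3.35) letter pair per component in the norm of `𝔄`, transport = fibrewise mean) over the SIZED unit-torus carrier on the product carrier `X × ι`,
blocks `liftBlk blkFine ι`, King's pairing lifted by `liftMap`, scale shift `m`, rate number `θ_j`.
[cite: Balaban1985BackgroundPropagators, Thm 3.14 pp.426–427 (typing template); (3.35) p.396; (3.50)–(3.52) p.400 (the gauge-field species, shape)] -/
def gaugeVecInstanceM (hL : 1 ≤ L) (j : VecIndexS d L) : PairedInstance :=
  gaugeInstanceM 𝔄 (Fin (d + 1)) ι (g := unitTorusGeoS L j.k j.Mn j.Msz) (blkFine L j.k j.Mn) (kingPrV L j.k j.m j.Mn) j.m (unitTorusGeoS_L_ne_zero L hL j)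
    (thetaV L j) (thetaV L j)

/-- THE REALISED NON-ABELIAN GAUGE-FIELD KERNEL FAMILY: G2's `gaugeFamilyM4` (the first-order perturbation's MATRIX coefficients DERIVED from `A′` through
`Phi1(η, ad_A)` in the coordinates `e`, M1's pair and all four (3.42) entries CONSTRUCTED) fed with the -a pieces of the vector single-scale piece TENSORED WITH
`1_𝔤` at the index, both spacings (direction `ν = j.ν`). [cite: Balaban1985BackgroundPropagators, (3.42) + (3.44) p.397, (3.50)–(3.52) p.400, (3.63)–(3.65) pp.402–403 (shapes, mechanism)] -/
def gaugeVecFamilyM4 (hL : 1 ≤ L) (j : VecIndexS d L) :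
    B9.KernelFamily (gaugeVecInstanceM (d := d) 𝔄 ι L hL j).gc (gaugeVecInstanceM (d := d) 𝔄 ι L hL j).Bf :=
  gaugeFamilyM4 e (g := unitTorusGeoS L j.k j.Mn j.Msz) (blkFine L j.k j.Mn) (kingPrV L j.k j.m j.Mn) j.m (unitTorusGeoS_L_ne_zero L hL j) (thetaV L j)
    (thetaV L j) j.ν
    (tensorId ι (pieceG L j.Mn (L ^ j.k) j.k (rweight (d := d) L j.k))) (tensorId ι (pieceS L j.Mn (L ^ j.k) j.k (rweight (d := d) L j.k) j.ν))
    (tensorId ι (pieceD3 L j.Mn (L ^ j.k) j.k (rweight (d := d) L j.k)))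
    (fun μ => tensorId ι (pieceD1 L j.Mn (L ^ j.k) j.k (rweight (d := d) L j.k) μ))
    (fun μ => tensorId ι (pieceM L j.Mn (L ^ j.k) j.k (rweight (d := d) L j.k) μ j.ν))
    (tensorId ι (pieceG L j.Mn (L ^ j.m * L ^ j.k) (j.k + j.m) (rweight (d := d) L j.k / ((L : ℝ) ^ j.m) ^ (d + 1))))
    (tensorId ι (pieceS L j.Mn (L ^ j.m * L ^ j.k) (j.k + j.m) (rweight (d := d) L j.k / ((L : ℝ) ^ j.m) ^ (d + 1)) j.ν))
    (tensorId ι (pieceD3 L j.Mn (L ^ j.m * L ^ j.k) (j.k + j.m) (rweight (d := d) L j.k / ((L : ℝ) ^ j.m) ^ (d + 1))))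
    (fun μ => tensorId ι (pieceD1 L j.Mn (L ^ j.m * L ^ j.k) (j.k + j.m) (rweight (d := d) L j.k / ((L : ℝ) ^ j.m) ^ (d + 1)) μ))
    (fun μ => tensorId ι (pieceM L j.Mn (L ^ j.m * L ^ j.k) (j.k + j.m) (rweight (d := d) L j.k / ((L : ℝ) ^ j.m) ^ (d + 1)) μ j.ν))

omit [DecidableEq ι] [CompleteSpace 𝔄] in
/-- **THE GUARD IS LIVE**: the fine realised non-abelian gauge-field instance's [B9] size parameter IS the index's `M`. [folklore] -/
theorem gaugeVecInstanceM_gf_M (hL : 1 ≤ L) (j : VecIndexS d L) : (gaugeVecInstanceM (d := d) 𝔄 ι L hL j).gf.M = j.Msz := rfl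

omit [DecidableEq ι] [CompleteSpace 𝔄] in
/-- WHAT (3.35) SAYS HERE for the non-abelian gauge field: `A′` is `Reg335 c₃₅ α₀`-regular iff every component `A′_μ` has `‖A′_μ(x′)‖ ≤ c₃₅·M·α₀` pointwise (in the
norm of `𝔄`) and fibrewise oscillation `‖A′_μ(x₁′) − A′_μ(x₂′)‖ ≤ c₃₅·M·α₀·θ_j` over every King fibre (lifted to the product carrier) — «|A| < O(1)Mα₀(L^jη)^{−1},
|∇^ηA| < O(1)Mα₀(L^jη)^{−2} on □» read blockwise. [cite: Balaban1985BackgroundPropagators, (3.35) p.396] -/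
theorem reg335_gaugeVecM_iff (hL : 1 ≤ L) (j : VecIndexS d L) (c35 α₀ : ℝ)
    (A' : Fin (d + 1) → Tor (fine (L ^ j.m * L ^ j.k) j.Mn) × Fin (d + 1) → 𝔄) :
    (gaugeVecInstanceM (d := d) 𝔄 ι L hL j).Bf.Reg335 c35 α₀ A' ↔
      (∀ μ x', ‖A' μ x'‖ ≤ c35 * j.Msz * α₀) ∧
        ∀ μ x₁' x₂', kingPrV L j.k j.m j.Mn x₁' = kingPrV L j.k j.m j.Mn x₂' → ‖A' μ x₁' - A' μ x₂'‖ ≤ c35 * j.Msz * α₀ * thetaV L j :=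
  Iff.rfl

end Family

/-! ## §2 THE NON-ABELIAN GAUGE-LIVE KNIT: `NE2PlusOperator` BY NAME, the print's matrix species, every U ≡ 1 input a tree theorem -/

section Knit

variable {𝔄 : Type} [NormedRing 𝔄] [NormedAlgebra ℝ 𝔄] [CompleteSpace 𝔄] {ι : Type} [Fintype ι] [DecidableEq ι] (e : 𝔄 ≃L[ℝ] (ι → ℝ)) {L : ℕ} [NeZero L]

/-- **NE2⁺, OPERATOR LAYER — THE NODE's FIRST CONJUNCT `T4EtaRate.NE2PlusOperator` BY NAME FOR THE U = 1 VECTOR SINGLE-SCALE PIECE `G ⊗ 1_𝔤` WITH THE NON-ABELIAN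
GAUGE FIELD LIVE**: the realised family over the `𝔄`-valued gauge-field carriers (configurations `A′ : Fin (d+1) → X′ → 𝔄`, (3.35) CONSUMED on `A′` itself in the norm
of `𝔄`, perturbation `V′ = D_{U′} − ∇′` with MATRIX coefficients DERIVED from `A′` by the transporter species `Phi1(η′, ad_{A′})` in the coordinates `e`, the
non-abelian pair and all four (3.42) entries CONSTRUCTED — G1∕G2 over M1), size guard LIVE (`gaugeVecInstanceM_gf_M`, unbounded `M`), and EVERY U ≡ 1 input — the
twelve hypothesis families of G2's `ne2PlusOperator_gaugeM`, lifted by `tensorId` — a landed theorem (M4's `uniform_layer_firstOrderM`; rate number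
`θ_j = (L^k)^{−¼} ≥ η = L^{−k}`, `η ≤ 1`, `L ≥ 1`).  G2 instantiated. [cite: Balaban1985BackgroundPropagators, Thm 3.1 p.397 (quantifier template), (3.35) p.396, (3.42) + (3.44) p.397, (3.50)–(3.52) p.400, (3.63)–(3.65) pp.402–403 (shapes, mechanism); King1986, (4.42)–(4.43) p.675; Balaban1984PropagatorsII, (2.156) p.250] -/
theorem ne2PlusOperator_vectorPiece_gaugeM4 (hd : 1 ≤ d) (hL : 1 ≤ L) (c35 : ℝ) (hc35 : 0 < c35) :
    NE2PlusOperator c35 (gaugeVecInstanceM (d := d) 𝔄 ι L hL) (gaugeVecFamilyM4 (d := d) 𝔄 ι e L hL) := by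
  obtain ⟨β, δ, m₀, hβ, hδ, hm₀, H⟩ := uniform_layer_firstOrderM (d := d) (ι := ι) (L := L) hd hL
  have hL0 : L ≠ 0 := by omega
  have hLr : (0 : ℝ) < (L : ℝ) := by exact_mod_cast (show 0 < L by omega)
  have hL1 : (1 : ℝ) ≤ (L : ℝ) := by exact_mod_cast hL
  have hσ : 0 < δ / 2 := half_pos hδ
  exact ne2PlusOperator_gaugeM e (I := VecIndexS d L) (J := Fin (d + 1)) (fun j => unitTorusGeoS L j.k j.Mn j.Msz)
    (fun j => Tor (fine (L ^ j.k) j.Mn) × Fin (d + 1)) (fun j => Tor (fine (L ^ j.m * L ^ j.k) j.Mn) × Fin (d + 1))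
    (fun j => blkFine L j.k j.Mn) (fun j => kingPrV L j.k j.m j.Mn) (fun j => j.m) (fun j => unitTorusGeoS_L_ne_zero L hL j) (thetaV L) (thetaV L)
    (fun j => j.ν)
    (fun j => tensorId ι (pieceG L j.Mn (L ^ j.k) j.k (rweight (d := d) L j.k)))
    (fun j => tensorId ι (pieceS L j.Mn (L ^ j.k) j.k (rweight (d := d) L j.k) j.ν))
    (fun j => tensorId ι (pieceD3 L j.Mn (L ^ j.k) j.k (rweight (d := d) L j.k)))
    (fun j μ => tensorId ι (pieceD1 L j.Mn (L ^ j.k) j.k (rweight (d := d) L j.k) μ))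
    (fun j μ => tensorId ι (pieceM L j.Mn (L ^ j.k) j.k (rweight (d := d) L j.k) μ j.ν))
    (fun j => tensorId ι (pieceG L j.Mn (L ^ j.m * L ^ j.k) (j.k + j.m) (rweight (d := d) L j.k / ((L : ℝ) ^ j.m) ^ (d + 1))))
    (fun j => tensorId ι (pieceS L j.Mn (L ^ j.m * L ^ j.k) (j.k + j.m) (rweight (d := d) L j.k / ((L : ℝ) ^ j.m) ^ (d + 1)) j.ν))
    (fun j => tensorId ι (pieceD3 L j.Mn (L ^ j.m * L ^ j.k) (j.k + j.m) (rweight (d := d) L j.k / ((L : ℝ) ^ j.m) ^ (d + 1))))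
    (fun j μ => tensorId ι (pieceD1 L j.Mn (L ^ j.m * L ^ j.k) (j.k + j.m) (rweight (d := d) L j.k / ((L : ℝ) ^ j.m) ^ (d + 1)) μ))
    (fun j μ => tensorId ι (pieceM L j.Mn (L ^ j.m * L ^ j.k) (j.k + j.m) (rweight (d := d) L j.k / ((L : ℝ) ^ j.m) ^ (d + 1)) μ j.ν))
    c35 hc35 (fun j => triangle254_unitTorusGeo L j.k j.Mn) (fun j a b => tdistT_nonneg _ _ _) hσ.le
    (B4Sect5Proof.latticeConst_nonneg (d + 1) hσ.le) (fun j => rowSum_unitTorusGeo L j.k j.Mn hσ)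
    (fun j => inv_pos.mpr (pow_pos hLr _)) (fun j => inv_le_one_of_one_le₀ (one_le_pow₀ hL1)) (fun j => inv_pow_le_rpow hL j.k (by norm_num))
    (fun j => hL1) (fun j y => (unitTorusGeo_len L j.k j.Mn hL0 y).symm.le)
    (by linarith) hβ.le hm₀.le (by norm_num : (0 : ℝ) < 1 / 4) (fun j y => le_rfl)
    (fun j => (H j).1) (fun j => (H j).2.1) (fun j => (H j).2.2.1) (fun j => (H j).2.2.2.1) (fun j => (H j).2.2.2.2.1)
    (fun j => (H j).2.2.2.2.2.1) (fun j => (H j).2.2.2.2.2.2.1) (fun j => (H j).2.2.2.2.2.2.2.1) (fun j => (H j).2.2.2.2.2.2.2.2.1)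
    (fun j => (H j).2.2.2.2.2.2.2.2.2.1) (fun j => (H j).2.2.2.2.2.2.2.2.2.2.1) (fun j => (H j).2.2.2.2.2.2.2.2.2.2.2)

/-- The four-dimensional non-abelian gauge-live instance (`d + 1 = 4`; e.g. `𝔄 = M₂(ℂ)` as a real algebra carrying `𝔤 = su(2)`, `ι` indexing a real basis).
[cite: Balaban1985BackgroundPropagators, Thm 3.1 p.397 (quantifier template)] -/
theorem ne2PlusOperator_vectorPiece_gaugeM4_dim4 (hL : 1 ≤ L) (c35 : ℝ) (hc35 : 0 < c35) :
    NE2PlusOperator c35 (gaugeVecInstanceM (d := 3) 𝔄 ι L hL) (gaugeVecFamilyM4 (d := 3) 𝔄 ι e L hL) :=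
  ne2PlusOperator_vectorPiece_gaugeM4 (d := 3) e (by norm_num) hL c35 hc35

/-- **NE2⁰ FOR THE SAME FAMILY — the node's fourth decl `T4EtaRate.NE2ZeroOperator` BY NAME**: at the trivial configuration `A′ = 0` (the carrier's
`one`; (3.35) holds there for every `α₀ > 0` since `M ≥ 1`, `θ_j ≥ 0`) the η-difference family of the non-abelian gauge-live vector piece obeys
`EtaRateIneq342` — `T4EtaRate.ne2Zero_of_ne2Plus` applied to `ne2PlusOperator_vectorPiece_gaugeM4` at `c₃₅ = 1`.
[cite: King1986, Props. 3.8–3.9 (3.71)–(3.75) pp.664–665 (A = 0 model); Balaban1985BackgroundPropagators, Thm 3.1 p.397 (quantifier template)] -/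
theorem ne2ZeroOperator_vectorPiece_gaugeM4 (hd : 1 ≤ d) (hL : 1 ≤ L) :
    Literature.MathematicalPhysics.QuantumFieldTheory.Balaban1983to89.T4EtaRate.NE2ZeroOperator (gaugeVecInstanceM (d := d) 𝔄 ι L hL)
      (gaugeVecFamilyM4 (d := d) 𝔄 ι e L hL) := by
  refine Literature.MathematicalPhysics.QuantumFieldTheory.Balaban1983to89.T4EtaRate.ne2Zero_of_ne2Plus (c35 := 1) (fun j α₀ hα₀ => ?_)
    (ne2PlusOperator_vectorPiece_gaugeM4 (d := d) e hd hL 1 one_pos)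
  have hM : 0 ≤ (1 : ℝ) * j.Msz * α₀ := by
    have h1 : (0 : ℝ) ≤ j.Msz := zero_le_one.trans j.one_le_Msz
    positivity
  have hθ : 0 ≤ thetaV L j := Real.rpow_nonneg (pow_nonneg (Nat.cast_nonneg L) _) _
  refine ⟨fun μ x' => ?_, fun μ x₁' x₂' _ => ?_⟩
  · show ‖(0 : 𝔄)‖ ≤ 1 * j.Msz * α₀
    rw [norm_zero]
    exact hM
  · show ‖(0 : 𝔄) - 0‖ ≤ 1 * j.Msz * α₀ * thetaV L j
    rw [sub_zero, norm_zero]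
    exact mul_nonneg hM hθ

/-- The four-dimensional instance of the NE2⁰ corollary. [cite: King1986, Props. 3.8–3.9 (3.71)–(3.75) pp.664–665 (A = 0 model)] -/
theorem ne2ZeroOperator_vectorPiece_gaugeM4_dim4 (hL : 1 ≤ L) :
    Literature.MathematicalPhysics.QuantumFieldTheory.Balaban1983to89.T4EtaRate.NE2ZeroOperator (gaugeVecInstanceM (d := 3) 𝔄 ι L hL)
      (gaugeVecFamilyM4 (d := 3) 𝔄 ι e L hL) :=
  ne2ZeroOperator_vectorPiece_gaugeM4 (d := 3) e (by norm_num) hL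

end Knit

end Summit.QuantumFields.YangMills.BalabanUVNodes.N15.VectorPiece

end
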